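import Summits.QuantumFields.YangMills.Theorems.BalabanUVNodesProp4KernelLetterHOfEntryBoundsPr
import Summits.QuantumFields.YangMills.Theorems.BalabanUVNodesC44IterMhRegularPrParam
import HarnessLib

/-!
# THE FREE-RADIUS CONE DOOR AND THE ONE-LETTER-FOR-H₁ DOOR OF THE FRAMED PROP. 4, PARAMETRIC IN THE FRAME CONSTANT — ✓`…Prop4AtRecordConeRadiusPr` and
# ✓`…Prop4KernelLetterHOfEntryBoundsPr` RE-PRESSED (`…_param`): `c𝔥 ∈ [0, 10¹⁰]` A BINDER, `C₂(c𝔥) = (6.4·10¹²·c𝔥 + 2.56·10¹⁶)·L·N` (file 2 of 2 of the downstream doors)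

Cell `pub-ymgap` ∕ `ym-nodeO-ideate`, porter lineage `ymgap-nodeO-port-PTB-1` (gen 10); director-ym g24 №630 (2)(iii) (parametric re-press, commissioned; deprecate-and-add, new decl
names; the `≤ 1000` editions stay as the special case they are).  `--kind proof --supports stmt-QuantumFields-27238 --as helper`; count-neutral; NEW basename; nothing appended,
nothing re-declared; ONE topic (the remaining two downstream doors of the Pr chain; the first two in ✓`…Prop4DoorsPrParam`), each in its source file's namespace and `open` context.
[B11] = [Balaban1985Variational]; [B9] = [Balaban1985BackgroundPropagators]; [B7] = [Balaban1985Averaging].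

WHAT IS PROVED (0 def, 0 sorry, axioms standard):
* `Prop4UniformAtRecord.prop4UniformPrAtRecord_node00_of_coneLetter_radius_param` (free radius `0 < r′ ≤ r(b, C₂(c𝔥))`);
* `Prop4UniformAtRecord.prop4UniformPrAtRecord_node00_of_h1EntryBounds_coneLetter_param` (one letter for H₁ via ✓`klH_of_entryBounds`).
Statements VERBATIM from the sources but for `{c𝔥 : ℝ} (hc0 : 0 ≤ c𝔥) (hc : c𝔥 ≤ 10¹⁰)` in place of `(hc : c𝔥 ≤ 1000)` and `C₂ := (6.4·10¹²·c𝔥 + 2.56·10¹⁶)·L·N` in every `letI`;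
proofs = the same glue with the `_param` supplier ✓`prop4LetterCPrAtRecord_of_regular_param` (the cone-radius door re-runs the G-door by hand, as its source does).

HONEST FRAMING.  Glue; (ℓa-H)ᵖʳ, (KL-H), (KL-C)∕`g₀`, (KL-N), (hdom)∕(hnear)∕(hmap)∕(hderiv) DISPLAYED (the frame debts are THEOREMS at the record's own datum, instantiated in the sequel);
constants crude; (R1)∕(R2) and [B7] Prop. 5 OPEN; K0ᴬ ⟨stmt-QuantumFields-27238⟩ NOT closed; NODE O 0∕1; COUNT 8∕28 · K 1∕4 UNMOVED; finite `𝕋⁴_{L^K}` at fixed ε — NOT continuum ∕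
ℝ⁴ ∕ OS ∕ Clay; **the Yang–Mills mass gap (Clay) is NOT proved by any of this.**  No `sorry`, `instance`, `notation`, `set_option`; standard axioms.
-/

noncomputable section

open scoped Matrix Matrix.Norms.L2Operator InnerProductSpace ComplexConjugate Topology BigOperators

namespace Summit.QuantumFields.YangMills.Theorems.Prop4UniformAtRecord

section ConeRadiusDoor

open Classical

open Literature.MathematicalPhysics.QuantumFieldTheory.Balaban1983to89
open Literature.MathematicalPhysics.QuantumFieldTheory.Balaban1983to89.Node00
open T4Continuum BlockAveraging
open B10Eq42TorusConstraint (bondsIn)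
open B10Eq38TorusDomains (toFine)
open B9SectCLatticeCarrier (Bond)
open B11Eq103H1Complex (SiteL2K)
open B11Eq115Space (NegSup NegSize levWeight)
open B11Eq90Transpose (single115)
open B11Eq90V0primeCurrent (flat115)
open B11Eq111FrakG (nabla115)
open Summit.QuantumFields.YangMills.Theorems.C44IterMh (prop4LetterCPrAtRecord_of_regular_param loopProfile_of_regular_below kernelLetterC_of_conePr
  norm_plaqHolU_unitsOfRecord_sub_one_le_of_plaqSmall plaqSmall_base_of_hreg levWeight_bondLevLit_eq_one levWeight_pairLevLit_eq_one wSup_le_one_of_eq_one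
  wInvSup_le_one_of_eq_one)

variable (F : T4Family) (N : ℕ) [NeZero N] (K k : ℕ) (Ω : ℕ → Set (Site (F.P K) 0)) (U₀ : GaugeField (F.P K) 0 (SU N))
variable [Fact (0 < (F.L : ℝ))] [Fact (0 < (F.P K).eta k)] [Fact (0 < c0Rec F K k)] [Fact (∀ c, 0 < wBRec F K k c)]

/-- ★★ **THE FREE-RADIUS CONE DOOR, PARAMETRIC IN `c𝔥`** — ✓`prop4UniformPrAtRecord_node00_of_coneLetter_radius` with `{c𝔥} (hc0 : 0 ≤ c𝔥) (hc : c𝔥 ≤ 10¹⁰)` and `C₂ := (6.4·10¹²·c𝔥 + 2.56·10¹⁶)·L·N` (any radius `0 < r′ ≤ r(b, C₂(c𝔥))`); glue with ✓`prop4LetterCPrAtRecord_of_regular_param`.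
[cite: Balaban1985Variational, Prop. 4 (97)–(98) pp.292–293, (14) p.280, (46) p.285, (86)–(89) p.291; Balaban1985Averaging, Proposition 5 (157) p.42, (92) p.31; Balaban1985BackgroundPropagators, (3.132) p.422] -/
theorem prop4UniformPrAtRecord_node00_of_coneLetter_radius_param [DecidableEq (PBond (F.P K) k)] (𝔥 : FrameDatum (F.P K) N k U₀) (levB : PBond (F.P K) k → ℕ) (a : ℝ)
    (hpos : ∀ x, x ≠ 0 → 0 < RCLike.re ⟪x, laplaceAOfRecord F N k U₀ (QprOfRecord F N k U₀ 𝔥) (QprimeOfRecord F N k U₀) a x⟫_ℂ)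
    (hQ : Function.Surjective (QprOfRecord F N k U₀ 𝔥))
    (Gp : SiteL2K ℂ (F.P K).d (fun _ => (F.P K).sitesPerDir 0) (c0Rec F K k) (WRec N) →ₗ[ℂ]
      SiteL2K ℂ (F.P K).d (fun _ => (F.P K).sitesPerDir 0) (c0Rec F K k) (WRec N))
    {b α nJ : ℝ} (hkpos : 0 < k) (hkm : k ≤ (F.P K).m + (F.P K).K) (hb : 0 ≤ b) (hΩ : ∀ x, x ∈ Ω k) (hα0 : 0 ≤ α) (hα : α * (11000000 * N) ≤ 1)
    (hreg : ∀ j, j < k → PlaqSmall (α * ((F.L : ℝ) ^ j * (F.P K).eta k) ^ 2) (Averaging.iter (avOfRecord F N K) j U₀))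
    {c𝔥 : ℝ} (hc0 : 0 ≤ c𝔥) (hc : c𝔥 ≤ 10000000000)
    (hdom : ∀ Y : PBond (F.P K) 0 → Matrix (Fin N) (Fin N) ℂ, (∀ b, (Y b).trace = 0) → (F.L : ℝ) ^ k * ‖Y‖ < 1 / (25000000000 * (F.L : ℝ) * N) →
      expOver U₀ Y ∈ 𝔥.dom)
    (hnear : ∀ Y : PBond (F.P K) 0 → Matrix (Fin N) (Fin N) ℂ, (∀ b, (Y b).trace = 0) → (F.L : ℝ) ^ k * ‖Y‖ < 1 / (25000000000 * (F.L : ℝ) * N) →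
      ∀ y : Site (F.P K) k, ‖𝔥.map (expOver U₀ Y) y - 1‖ ≤ c𝔥 * ((F.L : ℝ) ^ k * ‖Y‖) ∧ ‖𝔥.inv (expOver U₀ Y) y - 1‖ ≤ c𝔥 * ((F.L : ℝ) ^ k * ‖Y‖))
    (hmap : ∀ Y : Set (Site (F.P K) 0), (∀ i, i < k → ∀ s : Site (F.P K) i, toFine i s ∈ Y ↔ toFine (i + 1) (blockOf s) ∈ Y) →
      ∀ V V' : PBond (F.P K) 0 → Matrix (Fin N) (Fin N) ℂ, (∀ b : PBond (F.P K) 0, b ∈ bondsIn 0 Y → V b = V' b) →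
      ∀ y : Site (F.P K) k, toFine k y ∈ Y → 𝔥.map V y = 𝔥.map V' y ∧ 𝔥.inv V y = 𝔥.inv V' y)
    (hderiv : ∀ Y : Set (Site (F.P K) 0), (∀ i, i < k → ∀ s : Site (F.P K) i, toFine i s ∈ Y ↔ toFine (i + 1) (blockOf s) ∈ Y) →
      ∀ Z Z' : PBond (F.P K) 0 → Matrix (Fin N) (Fin N) ℂ, (∀ b : PBond (F.P K) 0, b ∈ bondsIn 0 Y → Z b = Z' b) →
      ∀ y : Site (F.P K) k, toFine k y ∈ Y → 𝔥.deriv Z y = 𝔥.deriv Z' y)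
    (hH : Prop4LetterHPrAtRecord F N K k Ω U₀ 𝔥 levB a hpos hQ b)
    -- the radius
    {r' : ℝ} (hr'0 : 0 < r')
    (hr'le : letI C₂ : ℝ := (6400000000000 * c𝔥 + 25600000000000000) * (F.L : ℝ) * N
      letI c₄ : ℝ := 1 / (200000000000 * (F.L : ℝ) * N)
      r' ≤ min (c₄ / 4) (min (1 / 2) (1 / (16 * (b * C₂ + 1)))))
    -- (KL-H)
    {hk : Bond (F.P K).d (fun _ => (F.P K).sitesPerDir 0) → PBond (F.P K) k → ℝ} (hk0 : ∀ b' y, 0 ≤ hk b' y)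
    (hHk : ∀ (y : PBond (F.P K) k) (Z : Matrix (Fin N) (Fin N) ℂ) (b' : Bond (F.P K).d (fun _ => (F.P K).sitesPerDir 0)),
      ‖flat115 (H1prOfRecordAtBg F N K k Ω U₀ 𝔥 levB a hpos hQ
          ((NegSup.equiv (levWeight (F.L : ℝ) ((F.P K).eta k) levB 0) (Matrix (Fin N) (Fin N) ℂ)).symm (Pi.single y Z))) b'‖ ≤ hk b' y * ‖Z‖)
    {ΘH : ℝ} (hΘH : 0 ≤ ΘH) (hH1 : ∀ y, ∑ b', hk b' y ≤ ΘH) {ΘHw : ℝ} (hΘHw : 0 ≤ ΘHw)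
    (hHw : ∀ (bb : Bond (F.P K).d (fun _ => (F.P K).sitesPerDir 0)) (y : PBond (F.P K) k),
      ∑ b', levWeight (F.L : ℝ) ((F.P K).eta k) (bondLevLit F Ω k) 3 bb / levWeight (F.L : ℝ) ((F.P K).eta k) (bondLevLit F Ω k) 3 b' * hk b' y ≤ ΘHw)
    -- the on-cone entry letter of `D C^{sl}` on `‖A‖ < 2r′`, and the window
    {g₀ : ℝ} (hg₀ : 0 ≤ g₀)
    (hg : ∀ A : Space115Lit F N K k Ω U₀, ‖A‖ < r' + r' → ∀ (bb : Bond (F.P K).d (fun _ => (F.P K).sitesPerDir 0)) (X : Matrix (Fin N) (Fin N) ℂ) (c : PBond (F.P K) k),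
      (bondToLit (F.P K) 0).symm bb ∈ bondsIn 0 {x : Site (F.P K) 0 | B14.Eq22Determines.blockIter k x = c.src ∨ B14.Eq22Determines.blockIter k x = c.tgt} →
      ‖NegSup.equiv (levWeight (F.L : ℝ) ((F.P K).eta k) levB 0) (Matrix (Fin N) (Fin N) ℂ)
        (fderiv ℂ (CslprOfRecord F N K k Ω U₀ 𝔥 levB) A
          (single115 (lev₁ := pairLevLit F Ω k) (Dc := nabla115 ((F.P K).eta k) (unitsOfRecord F N U₀)) bb X)) c‖ ≤ g₀ * ‖A‖ * ‖X‖)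
    (hq : (r' + r') * ΘH * (2 * ((F.P K).d : ℝ) * g₀) ≤ 1 / 2)
    -- (KL-N)
    {hk' : Bond (F.P K).d (fun _ => (F.P K).sitesPerDir 0) → PBond (F.P K) k → ℝ} (hk'0 : ∀ b' y, 0 ≤ hk' b' y)
    (hNk : ∀ (y : PBond (F.P K) k) (Z : Matrix (Fin N) (Fin N) ℂ) (b' : Bond (F.P K).d (fun _ => (F.P K).sitesPerDir 0)),
      ‖NegSup.equiv (levWeight (F.L : ℝ) ((F.P K).eta k) (bondLevLit F Ω k) 3) (Matrix (Fin N) (Fin N) ℂ)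
        (DeltaPiCurOfRecord F N K k Ω U₀ Gp (QprimeOfRecord F N k U₀) (H1prOfRecordAtBg F N K k Ω U₀ 𝔥 levB a hpos hQ
          ((NegSup.equiv (levWeight (F.L : ℝ) ((F.P K).eta k) levB 0) (Matrix (Fin N) (Fin N) ℂ)).symm (Pi.single y Z)))) b'‖ ≤ hk' b' y * ‖Z‖)
    {Θ' : ℝ} (hΘ'0 : 0 ≤ Θ')
    (hΘ' : ∀ (bb : Bond (F.P K).d (fun _ => (F.P K).sitesPerDir 0)) (y : PBond (F.P K) k),
      ∑ b', levWeight (F.L : ℝ) ((F.P K).eta k) (bondLevLit F Ω k) 3 bb / levWeight (F.L : ℝ) ((F.P K).eta k) (bondLevLit F Ω k) 1 b' * hk' b' y ≤ Θ')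
    {N₁ : ℝ} (hN₁0 : 0 ≤ N₁)
    (hN₁ : ∀ b', ∑ y, levWeight (F.L : ℝ) ((F.P K).eta k) (bondLevLit F Ω k) 3 b' / levWeight (F.L : ℝ) ((F.P K).eta k) levB 0 y * hk' b' y ≤ N₁)
    (hJ : ‖JOfRecordAtBg F N K k Ω U₀‖ ≤ nJ) :
    letI C₂ : ℝ := (6400000000000 * c𝔥 + 25600000000000000) * (F.L : ℝ) * N
    letI R' : ℝ := min r' ((1 - 4 * b * C₂ * (r' + r')) * (1 / 16))
    letI CV : ℝ := 1024 * (((F.P K).d - 1 : ℕ) : ℝ) * ((1 : ℝ) * 1) ^ 3 * N * (α * (1 : ℝ) ^ 2 + 1 / 16)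
        + (((F.P K).d - 1 : ℕ) : ℝ) * ((1 : ℝ) * 1) ^ 3 * (136 + 2 * ((1 : ℝ) * 1)) * N
    letI G : ℝ := 2 * ((F.P K).d : ℝ) * g₀
    letI θ₃ : ℝ := (2 * (1 / (1 - 4 * b * C₂ * (r' + r'))) + 1) * ΘHw * G / r'
    letI θE : ℝ := 2 * ΘHw * G * (1 / (1 - 4 * b * C₂ * (r' + r')))
    letI θE' : ℝ := 2 * Θ' * G * (1 / (1 - 4 * b * C₂ * (r' + r')))
    Prop4UniformPrAtRecord F N K k Ω U₀ 𝔥 levB a hpos hQ r' Gp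
      ((N * θ₃ * nJ + (N₁ * C₂ * (1 / (1 - 4 * b * C₂ * (r' + r'))) ^ 2 + N * θE')
        + N * θE * (N₁ * C₂ * (1 / (1 - 4 * b * C₂ * (r' + r'))) ^ 2) * R'
        + N * (1 + θE * R') * CV * (1 / (1 - 4 * b * C₂ * (r' + r'))) ^ 2)) R' := by
  have hLN : (0 : ℝ) < (F.L : ℝ) * N := mul_pos Fact.out (by exact_mod_cast Nat.pos_of_ne_zero (NeZero.ne N))
  have hC₂ : (0 : ℝ) ≤ (6400000000000 * c𝔥 + 25600000000000000) * (F.L : ℝ) * N := by rw [mul_assoc]; positivity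
  have hnum := prop4LetterNum_of_le hb hC₂ (by norm_num : (0 : ℝ) < 1 / 16) hr'0 hr'le
  have hC := prop4LetterCPrAtRecord_of_regular_param F N k Ω U₀ 𝔥 levB hΩ hα0 hα hreg hc0 hc hdom hnear
  have hU₀ : SmallBelow (avOfRecord F N K) k U₀ := (loopProfile_of_regular_below F N k U₀ le_rfl hα0 hα hreg).1
  obtain ⟨hgC0, hCg, hG⟩ := kernelLetterC_of_conePr F N K k Ω U₀ hkm 𝔥 levB hU₀ hmap hderiv hg₀ hg
  have hG0 : 0 ≤ 2 * ((F.P K).d : ℝ) * g₀ := by positivity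
  have hcol := prop4LetterColumnsPrAtRecord_of_kernelLetters F N K k Ω U₀ 𝔥 levB a hpos hQ Gp hH hC hnum hr'0 hk0 hHk hΘH hH1 hΘHw hHw hgC0 hCg hG0 hG hq
    hk'0 hNk hΘ'0 hΘ' hN₁0 hN₁
  have hpl := norm_plaqHolU_unitsOfRecord_sub_one_le_of_plaqSmall F N U₀ (plaqSmall_base_of_hreg F N U₀ hkpos hreg)
  have hwb : ∀ i, levWeight (F.L : ℝ) ((F.P K).eta k) (bondLevLit F Ω k) 1 i = 1 := levWeight_bondLevLit_eq_one F k Ω hΩ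
  have hwp : ∀ p, levWeight (F.L : ℝ) ((F.P K).eta k) (pairLevLit F Ω k) 2 p = 1 := levWeight_pairLevLit_eq_one F K k Ω hΩ
  have hV := prop4LetterV0AtRecord_of_window F N K k Ω U₀ hα0 hpl le_rfl le_rfl (wSup_le_one_of_eq_one _ hwb) (wInvSup_le_one_of_eq_one _ hwb)
    (wInvSup_le_one_of_eq_one _ hwp)
  have hmain := prop4UniformPrAtRecord_of_letters_of_norm_J_le F N K k Ω U₀ 𝔥 levB a hpos hQ Gp hH hC hnum hV (prop4LetterSymmPrAtRecord_holds F N K k Ω U₀ Gp) hcol hJ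
  obtain ⟨⟨hθ₃, hθE, hθE', hN₁'⟩, -⟩ := hcol
  exact prop4UniformPrAtRecord_mono F N K k Ω U₀ 𝔥 levB a hpos hQ _ Gp hmain
    (c4OfRecord_le_numeric N ((norm_nonneg _).trans hJ) hV.1 hnum.2.2.2.2.2.2.1 hθ₃ hθE hθE' hN₁' hC₂)

end ConeRadiusDoor

end Summit.QuantumFields.YangMills.Theorems.Prop4UniformAtRecord

namespace Summit.QuantumFields.YangMills.Theorems.Prop4UniformAtRecord

section KLHDoor

open Literature.MathematicalPhysics.QuantumFieldTheory.Balaban1983to89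
open Literature.MathematicalPhysics.QuantumFieldTheory.Balaban1983to89.Node00
open T4Continuum BlockAveraging
open B10Eq42TorusConstraint (bondsIn)
open B10Eq38TorusDomains (toFine)
open B9SectCLatticeCarrier (Bond)
open B11Eq103H1Complex (SiteL2K)
open B11Eq115Space (NegSup NegSize levWeight)
open B11Eq90Transpose (single115)
open B11Eq90V0primeCurrent (flat115)
open B11Eq111FrakG (nabla115)
open Summit.QuantumFields.YangMills.BalabanUVNodes.N07KernelEntriesOfRecord (colOp entry0 entry1 klH_of_entryBounds)
open Summit.QuantumFields.YangMills.BalabanUVNodes.N07FramedLettersOfThm312313 (prop4LetterHPrAtRecord_of_entryBounds)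

variable (F : T4Family) (N : ℕ) [NeZero N] (K k : ℕ) (Ω : ℕ → Set (Site (F.P K) 0)) (U₀ : GaugeField (F.P K) 0 (SU N))
variable [Fact (0 < (F.L : ℝ))] [Fact (0 < (F.P K).eta k)] [Fact (0 < c0Rec F K k)] [Fact (∀ c, 0 < wBRec F K k c)] (𝔥 : FrameDatum (F.P K) N k U₀)
  (levB : PBond (F.P K) k → ℕ) (a : ℝ)
  (hpos : ∀ x, x ≠ 0 → 0 < RCLike.re ⟪x, laplaceAOfRecord F N k U₀ (QprOfRecord F N k U₀ 𝔥) (QprimeOfRecord F N k U₀) a x⟫_ℂ)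
  (hQ : Function.Surjective (QprOfRecord F N k U₀ 𝔥))

/-- ★★ **THE ONE-LETTER-FOR-H₁ DOOR, PARAMETRIC IN `c𝔥`** — ✓`prop4UniformPrAtRecord_node00_of_h1EntryBounds_coneLetter` with `{c𝔥} (hc0 : 0 ≤ c𝔥) (hc : c𝔥 ≤ 10¹⁰)` and `C₂ := (6.4·10¹²·c𝔥 + 2.56·10¹⁶)·L·N`; glue over ✓`klH_of_entryBounds` ∘ ✓`prop4UniformPrAtRecord_node00_of_coneLetter_radius_param`.
[cite: Balaban1985Variational, Prop. 4 (97)–(98) pp.292–293, (14) p.280, (46) p.285, (86)–(89) p.291; Balaban1985BackgroundPropagators, (3.133) p.422, Thm 3.12 pp.423–424; Balaban1985Averaging, Proposition 5 (157) p.42, (92) p.31; Balaban1984PropagatorsII, (2.61) p.234] -/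
theorem prop4UniformPrAtRecord_node00_of_h1EntryBounds_coneLetter_param [DecidableEq (PBond (F.P K) k)]
    (Gp : SiteL2K ℂ (F.P K).d (fun _ => (F.P K).sitesPerDir 0) (c0Rec F K k) (WRec N) →ₗ[ℂ]
      SiteL2K ℂ (F.P K).d (fun _ => (F.P K).sitesPerDir 0) (c0Rec F K k) (WRec N))
    {α nJ : ℝ} (hkpos : 0 < k) (hkm : k ≤ (F.P K).m + (F.P K).K) (hΩ : ∀ x, x ∈ Ω k) (hα0 : 0 ≤ α) (hα : α * (11000000 * N) ≤ 1)
    (hreg : ∀ j, j < k → PlaqSmall (α * ((F.L : ℝ) ^ j * (F.P K).eta k) ^ 2) (Averaging.iter (avOfRecord F N K) j U₀))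
    -- the frame datum's displayed debts: window, near-one (scaled), block-locality
    {c𝔥 : ℝ} (hc0 : 0 ≤ c𝔥) (hc : c𝔥 ≤ 10000000000)
    (hdom : ∀ Y : PBond (F.P K) 0 → Matrix (Fin N) (Fin N) ℂ, (∀ b, (Y b).trace = 0) → (F.L : ℝ) ^ k * ‖Y‖ < 1 / (25000000000 * (F.L : ℝ) * N) →
      expOver U₀ Y ∈ 𝔥.dom)
    (hnear : ∀ Y : PBond (F.P K) 0 → Matrix (Fin N) (Fin N) ℂ, (∀ b, (Y b).trace = 0) → (F.L : ℝ) ^ k * ‖Y‖ < 1 / (25000000000 * (F.L : ℝ) * N) →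
      ∀ y : Site (F.P K) k, ‖𝔥.map (expOver U₀ Y) y - 1‖ ≤ c𝔥 * ((F.L : ℝ) ^ k * ‖Y‖) ∧ ‖𝔥.inv (expOver U₀ Y) y - 1‖ ≤ c𝔥 * ((F.L : ℝ) ^ k * ‖Y‖))
    (hmap : ∀ Y : Set (Site (F.P K) 0), (∀ i, i < k → ∀ s : Site (F.P K) i, toFine i s ∈ Y ↔ toFine (i + 1) (blockOf s) ∈ Y) →
      ∀ V V' : PBond (F.P K) 0 → Matrix (Fin N) (Fin N) ℂ, (∀ b : PBond (F.P K) 0, b ∈ bondsIn 0 Y → V b = V' b) →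
      ∀ y : Site (F.P K) k, toFine k y ∈ Y → 𝔥.map V y = 𝔥.map V' y ∧ 𝔥.inv V y = 𝔥.inv V' y)
    (hderiv : ∀ Y : Set (Site (F.P K) 0), (∀ i, i < k → ∀ s : Site (F.P K) i, toFine i s ∈ Y ↔ toFine (i + 1) (blockOf s) ∈ Y) →
      ∀ Z Z' : PBond (F.P K) 0 → Matrix (Fin N) (Fin N) ℂ, (∀ b : PBond (F.P K) 0, b ∈ bondsIn 0 Y → Z b = Z' b) →
      ∀ y : Site (F.P K) k, toFine k y ∈ Y → 𝔥.deriv Z y = 𝔥.deriv Z' y)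
    -- the (3.133)-shaped entry bounds of the FRAMED `H₁(U₀)` (zeroth and first entries, n07-e's generic `entry0`∕`entry1`)
    {B₀ ρ : ℝ} (hB₀ : 0 ≤ B₀) (hρ : 0 < ρ)
    (h0 : ∀ y y' : PBond (F.P K) k, entry0 F N K k Ω U₀ levB (H1prOfRecordAtBg F N K k Ω U₀ 𝔥 levB a hpos hQ) y y' ≤ B₀ * Real.exp (-(ρ * (Site.tdist y.src y'.src : ℝ))))
    (h1 : ∀ y y' : PBond (F.P K) k, entry1 F N K k Ω U₀ levB (H1prOfRecordAtBg F N K k Ω U₀ 𝔥 levB a hpos hQ) y y' ≤ B₀ * Real.exp (-(ρ * (Site.tdist y.src y'.src : ℝ))))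
    -- the radius
    {r' : ℝ} (hr'0 : 0 < r')
    (hr'le : letI C₂ : ℝ := (6400000000000 * c𝔥 + 25600000000000000) * (F.L : ℝ) * N
      letI c₄ : ℝ := 1 / (200000000000 * (F.L : ℝ) * N)
      letI b : ℝ := B₀ * ((F.P K).d * (2 * (1 + 1 / ρ)) ^ (F.P K).d)
      r' ≤ min (c₄ / 4) (min (1 / 2) (1 / (16 * (b * C₂ + 1)))))
    -- the on-cone entry letter of `D C^{sl}` on `‖A‖ < 2r′`, and the window against `Θ_H = L^{kd}·B₀·d·(2(1+1/ρ))^d`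
    {g₀ : ℝ} (hg₀ : 0 ≤ g₀)
    (hg : ∀ A : Space115Lit F N K k Ω U₀, ‖A‖ < r' + r' → ∀ (bb : Bond (F.P K).d (fun _ => (F.P K).sitesPerDir 0)) (X : Matrix (Fin N) (Fin N) ℂ) (c : PBond (F.P K) k),
      (bondToLit (F.P K) 0).symm bb ∈ bondsIn 0 {x : Site (F.P K) 0 | B14.Eq22Determines.blockIter k x = c.src ∨ B14.Eq22Determines.blockIter k x = c.tgt} →
      ‖NegSup.equiv (levWeight (F.L : ℝ) ((F.P K).eta k) levB 0) (Matrix (Fin N) (Fin N) ℂ)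
        (fderiv ℂ (CslprOfRecord F N K k Ω U₀ 𝔥 levB) A
          (single115 (lev₁ := pairLevLit F Ω k) (Dc := nabla115 ((F.P K).eta k) (unitsOfRecord F N U₀)) bb X)) c‖ ≤ g₀ * ‖A‖ * ‖X‖)
    (hq : (r' + r') * (((((F.P K).L ^ (F.P K).d) ^ k : ℕ) : ℝ) * (B₀ * ((F.P K).d * (2 * (1 + 1 / ρ)) ^ (F.P K).d))) * (2 * ((F.P K).d : ℝ) * g₀) ≤ 1 / 2)
    -- (KL-N)
    {hk' : Bond (F.P K).d (fun _ => (F.P K).sitesPerDir 0) → PBond (F.P K) k → ℝ} (hk'0 : ∀ b' y, 0 ≤ hk' b' y)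
    (hNk : ∀ (y : PBond (F.P K) k) (Z : Matrix (Fin N) (Fin N) ℂ) (b' : Bond (F.P K).d (fun _ => (F.P K).sitesPerDir 0)),
      ‖NegSup.equiv (levWeight (F.L : ℝ) ((F.P K).eta k) (bondLevLit F Ω k) 3) (Matrix (Fin N) (Fin N) ℂ)
        (DeltaPiCurOfRecord F N K k Ω U₀ Gp (QprimeOfRecord F N k U₀) (H1prOfRecordAtBg F N K k Ω U₀ 𝔥 levB a hpos hQ
          ((NegSup.equiv (levWeight (F.L : ℝ) ((F.P K).eta k) levB 0) (Matrix (Fin N) (Fin N) ℂ)).symm (Pi.single y Z)))) b'‖ ≤ hk' b' y * ‖Z‖)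
    {Θ' : ℝ} (hΘ'0 : 0 ≤ Θ')
    (hΘ' : ∀ (bb : Bond (F.P K).d (fun _ => (F.P K).sitesPerDir 0)) (y : PBond (F.P K) k),
      ∑ b', levWeight (F.L : ℝ) ((F.P K).eta k) (bondLevLit F Ω k) 3 bb / levWeight (F.L : ℝ) ((F.P K).eta k) (bondLevLit F Ω k) 1 b' * hk' b' y ≤ Θ')
    {N₁ : ℝ} (hN₁0 : 0 ≤ N₁)
    (hN₁ : ∀ b', ∑ y, levWeight (F.L : ℝ) ((F.P K).eta k) (bondLevLit F Ω k) 3 b' / levWeight (F.L : ℝ) ((F.P K).eta k) levB 0 y * hk' b' y ≤ N₁)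
    (hJ : ‖JOfRecordAtBg F N K k Ω U₀‖ ≤ nJ) :
    letI C₂ : ℝ := (6400000000000 * c𝔥 + 25600000000000000) * (F.L : ℝ) * N
    letI b : ℝ := B₀ * ((F.P K).d * (2 * (1 + 1 / ρ)) ^ (F.P K).d)
    letI ΘHw : ℝ := ((((F.P K).L ^ (F.P K).d) ^ k : ℕ) : ℝ) * (B₀ * ((F.P K).d * (2 * (1 + 1 / ρ)) ^ (F.P K).d))
    letI R' : ℝ := min r' ((1 - 4 * b * C₂ * (r' + r')) * (1 / 16))
    letI CV : ℝ := 1024 * (((F.P K).d - 1 : ℕ) : ℝ) * ((1 : ℝ) * 1) ^ 3 * N * (α * (1 : ℝ) ^ 2 + 1 / 16)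
        + (((F.P K).d - 1 : ℕ) : ℝ) * ((1 : ℝ) * 1) ^ 3 * (136 + 2 * ((1 : ℝ) * 1)) * N
    letI G : ℝ := 2 * ((F.P K).d : ℝ) * g₀
    letI θ₃ : ℝ := (2 * (1 / (1 - 4 * b * C₂ * (r' + r'))) + 1) * ΘHw * G / r'
    letI θE : ℝ := 2 * ΘHw * G * (1 / (1 - 4 * b * C₂ * (r' + r')))
    letI θE' : ℝ := 2 * Θ' * G * (1 / (1 - 4 * b * C₂ * (r' + r')))
    Prop4UniformPrAtRecord F N K k Ω U₀ 𝔥 levB a hpos hQ r' Gp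
      ((N * θ₃ * nJ + (N₁ * C₂ * (1 / (1 - 4 * b * C₂ * (r' + r'))) ^ 2 + N * θE')
        + N * θE * (N₁ * C₂ * (1 / (1 - 4 * b * C₂ * (r' + r'))) ^ 2) * R'
        + N * (1 + θE * R') * CV * (1 / (1 - 4 * b * C₂ * (r' + r'))) ^ 2)) R' := by
  have hb : 0 ≤ B₀ * ((F.P K).d * (2 * (1 + 1 / ρ)) ^ (F.P K).d) := by positivity
  obtain ⟨hk0, hHk', hΘ, hH1, hHw⟩ := klH_of_entryBounds F N K k Ω U₀ levB (H1prOfRecordAtBg F N K k Ω U₀ 𝔥 levB a hpos hQ) hΩ hkm hB₀ hρ h0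
  -- the one-block bound read with this statement's decidability instance inside `Pi.single` (instances are subsingletons)
  have hHk : ∀ (y : PBond (F.P K) k) (Z : Matrix (Fin N) (Fin N) ℂ) (b' : Bond (F.P K).d (fun _ => (F.P K).sitesPerDir 0)),
      ‖flat115 (H1prOfRecordAtBg F N K k Ω U₀ 𝔥 levB a hpos hQ
          ((NegSup.equiv (levWeight (F.L : ℝ) ((F.P K).eta k) levB 0) (Matrix (Fin N) (Fin N) ℂ)).symm (Pi.single y Z))) b'‖ ≤
        ‖colOp F N K k Ω U₀ levB (H1prOfRecordAtBg F N K k Ω U₀ 𝔥 levB a hpos hQ) y b'‖ * ‖Z‖ := fun y Z b' => by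
    convert hHk' y Z b' using 6
  exact prop4UniformPrAtRecord_node00_of_coneLetter_radius_param F N K k Ω U₀ 𝔥 levB a hpos hQ Gp hkpos hkm hb hΩ hα0 hα hreg hc0 hc hdom hnear hmap hderiv
    (prop4LetterHPrAtRecord_of_entryBounds (F := F) (N := N) K k Ω U₀ 𝔥 levB a hpos hQ hΩ hB₀ hρ h0 h1) hr'0 hr'le
    (hk := fun b' y => ‖colOp F N K k Ω U₀ levB (H1prOfRecordAtBg F N K k Ω U₀ 𝔥 levB a hpos hQ) y b'‖) hk0 hHk hΘ hH1 hΘ hHw hg₀ hg hq hk'0 hNk hΘ'0 hΘ' hN₁0 hN₁ hJ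

end KLHDoor

end Summit.QuantumFields.YangMills.Theorems.Prop4UniformAtRecord

end
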